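import Summits.KontsevichZagierPeriods.KontsevichZagierPeriods.Theorems.SoloBlindCyclicForm
import HarnessLib

/-!
# The second-kind form `(z^α (1-z)^β - λ z^σ - μ (1-z)^σ) dz`, I: calculus

For Beta words of the **second kind** (`1 < a + b < 2`, i.e. `σ = α + β ∈ (-1, 0)` with
`α = a - 1`, `β = b - 1`) the form `z^α (1-z)^β dz` of `SoloBlindCyclicForm` is not integrable
at infinity.  The cure is a **real, non-exact counterterm**: the Green datum is
`g(z) = z^α (1-z)^β - λ z^σ - μ (1-z)^σ` with real constants `λ, μ`; when
`λ + μ cos(πσ) = cos(πβ)` and `μ sin(πσ) = sin(πβ)` the leading term at infinity cancels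
(file `SoloBlindSecondAsymp`).  This file: the derivative, the boundary values on the real axis
(`Im g(x) = sin(πα) ((-x)^α (1-x)^β - (-x)^σ)` for `x < 0` when `λ sin(πσ) = sin(πα)`, and
`Im g(x) = 0` on `(0,1)`), the conjugation symmetry on `x = ½` under `(α, λ) ↔ (β, μ)` (the pair
trick survives because `λ, μ` are real), boundary continuity and decay.

References: Whittaker–Watson, *Modern Analysis*, §12.43 (Pochhammer's regularisation of the
Beta integral); Kontsevich–Zagier, *Periods* (2001), §1.2.
-/

noncomputable section

open Set Complex MeasureTheory Filter
open scoped Topology ComplexConjugate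
open Literature.NumberTheory.Transcendental
open Literature.NumberTheory.Transcendental.KZ

namespace Summit.KontsevichZagierPeriods.KontsevichZagierPeriods.Theorems

namespace SoloBlind

/-! ## The form and its derivative -/

/-- `g(z) = z^α (1-z)^β - λ z^{α+β} - μ (1-z)^{α+β}`. -/
def gK (α β l m : ℝ) (z : ℂ) : ℂ :=
  gTwo α β z - (l : ℂ) * z ^ ((α + β : ℝ) : ℂ) - (m : ℂ) * (1 - z) ^ ((α + β : ℝ) : ℂ)

/-- `g'(z) = g_{αβ}'(z) - λ σ z^{σ-1} + μ σ (1-z)^{σ-1}`, `σ = α + β`. -/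
def gKDer (α β l m : ℝ) (z : ℂ) : ℂ :=
  gTwoDer α β z - (l : ℂ) * (((α + β : ℝ) : ℂ) * z ^ (((α + β : ℝ) : ℂ) - 1)) +
    (m : ℂ) * (((α + β : ℝ) : ℂ) * (1 - z) ^ (((α + β : ℝ) : ℂ) - 1))

/-- The complex derivative of `g` off the cuts. -/
theorem hasDerivAt_gK (α β l m : ℝ) {z : ℂ} (h1 : z ∈ slitPlane) (h2 : 1 - z ∈ slitPlane) :
    HasDerivAt (gK α β l m) (gKDer α β l m z) z := by
  have ha := (hasDerivAt_id z).cpow_const (c := ((α + β : ℝ) : ℂ)) h1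
  have hb := ((hasDerivAt_id z).const_sub 1).cpow_const (c := ((α + β : ℝ) : ℂ)) h2
  have h := ((hasDerivAt_gTwo α β h1 h2).sub (ha.const_mul (l : ℂ))).sub (hb.const_mul (m : ℂ))
  have hfun : gK α β l m = fun w => gTwo α β w - (l : ℂ) * w ^ ((α + β : ℝ) : ℂ) -
      (m : ℂ) * (1 - w) ^ ((α + β : ℝ) : ℂ) := by
    funext w; rfl
  rw [hfun]
  refine h.congr_deriv ?_
  rw [gKDer]
  simp only [id]
  ring

/-- `g'` is continuous off the cuts. -/
theorem continuousAt_gKDer (α β l m : ℝ) {z : ℂ} (h1 : z ∈ slitPlane) (h2 : 1 - z ∈ slitPlane) :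
    ContinuousAt (gKDer α β l m) z :=
  ((continuousAt_gTwoDer α β h1 h2).sub (continuousAt_const.mul
    (continuousAt_const.mul (continuousAt_cpow_const_of_mem h1 _)))).add
    (continuousAt_const.mul (continuousAt_const.mul (continuousAt_one_sub_cpow_const h2 _)))

/-! ## Boundary values on the real axis -/

/-- On `(0,1)`: `g(x)` is real. -/
theorem gK_ofReal_pos {α β x : ℝ} (l m : ℝ) (hx0 : 0 < x) (hx1 : x < 1) :
    gK α β l m x = ((x ^ α * (1 - x) ^ β - l * x ^ (α + β) - m * (1 - x) ^ (α + β) : ℝ) : ℂ) := by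
  rw [gK, gTwo_ofReal_pos hx0 hx1, show (1 : ℂ) - (x : ℂ) = ((1 - x : ℝ) : ℂ) by push_cast; ring,
    ← ofReal_cpow hx0.le, ← ofReal_cpow (by linarith)]
  push_cast
  ring

/-- `Im g(x) = 0` for `0 < x < 1`. -/
theorem im_gK_ofReal_pos {α β x : ℝ} (l m : ℝ) (hx0 : 0 < x) (hx1 : x < 1) :
    (gK α β l m x).im = 0 := by
  rw [gK_ofReal_pos l m hx0 hx1, ofReal_im]

/-- `Im (x^σ) = sin(πσ) (-x)^σ` for `x < 0` (boundary value from the upper half-plane). -/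
theorem im_ofReal_cpow_neg {x : ℝ} (hx : x < 0) (σ : ℝ) :
    (((x : ℂ)) ^ ((σ : ℝ) : ℂ)).im = Real.sin (Real.pi * σ) * (-x) ^ σ := by
  rw [ofReal_cpow_of_nonpos hx.le, ← ofReal_neg, ← ofReal_cpow (by linarith),
    show cexp ((Real.pi : ℂ) * I * (σ : ℂ)) = cexp (((Real.pi * σ : ℝ) : ℂ) * I) by
      push_cast; ring_nf, im_ofReal_mul, exp_ofReal_mul_I_im, mul_comm]

/-- `Im ((1-x)^σ) = 0` for `x < 1`. -/
theorem im_one_sub_ofReal_cpow {x : ℝ} (hx : x < 1) (σ : ℝ) :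
    ((1 - (x : ℂ)) ^ ((σ : ℝ) : ℂ)).im = 0 := by
  rw [show (1 : ℂ) - (x : ℂ) = ((1 - x : ℝ) : ℂ) by push_cast; ring, ← ofReal_cpow (by linarith),
    ofReal_im]

/-- `Im g(x) = sin(πα) ((-x)^α (1-x)^β - (-x)^σ)` for `x < 0`, when `λ sin(πσ) = sin(πα)`. -/
theorem im_gK_ofReal_neg {α β l x : ℝ} (m : ℝ) (hx : x < 0)
    (hl : l * Real.sin (Real.pi * (α + β)) = Real.sin (Real.pi * α)) :
    (gK α β l m x).im =
      Real.sin (Real.pi * α) * ((-x) ^ α * (1 - x) ^ β - (-x) ^ (α + β)) := by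
  rw [gK, sub_im, sub_im, im_gTwo_ofReal_neg hx, im_ofReal_mul, im_ofReal_mul,
    im_ofReal_cpow_neg hx, im_one_sub_ofReal_cpow (by linarith), mul_zero, sub_zero]
  linear_combination (-((-x) ^ (α + β))) * hl

/-! ## The symmetry on the axis `x = ½` -/

/-- **The pair trick survives the counterterm**: `g_{β,α;μ,λ}(½+iy) = conj g_{α,β;λ,μ}(½+iy)`. -/
theorem gK_swap_half (α β l m y : ℝ) :
    gK β α m l (((1 / 2 : ℝ) : ℂ) + y * I) = conj (gK α β l m (((1 / 2 : ℝ) : ℂ) + y * I)) := by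
  have hz : conj (((1 / 2 : ℝ) : ℂ) + y * I) = 1 - ((((1 / 2 : ℝ) : ℂ)) + y * I) := by
    apply Complex.ext
    · simp; norm_num
    · simp
  have h1z : conj (1 - ((((1 / 2 : ℝ) : ℂ)) + y * I)) = ((1 / 2 : ℝ) : ℂ) + y * I := by
    rw [map_sub, map_one, hz, sub_sub_cancel]
  have hre1 : 0 < ((((1 / 2 : ℝ) : ℂ)) + y * I).re := by simp
  have hre2 : 0 < (1 - ((((1 / 2 : ℝ) : ℂ)) + y * I)).re := by simp; norm_num
  rw [gK, gK, gTwo_swap_half, map_sub, map_sub, map_mul, map_mul, conj_ofReal, conj_ofReal,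
    conj_cpow_ofReal_of_re_pos hre1, conj_cpow_ofReal_of_re_pos hre2, hz, h1z, add_comm β α]
  ring

/-- Hence `Re g_{β,α;μ,λ}(½+iy) = Re g_{α,β;λ,μ}(½+iy)`. -/
theorem re_gK_swap_half (α β l m y : ℝ) :
    (gK β α m l (((1 / 2 : ℝ) : ℂ) + y * I)).re = (gK α β l m (((1 / 2 : ℝ) : ℂ) + y * I)).re := by
  rw [gK_swap_half, conj_re]

/-! ## Boundary continuity -/

/-- Continuity of `y ↦ (x+iy)^c` from the closed upper half-plane at `y = 0`, `x ≠ 0`. -/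
theorem continuousWithinAt_cpow_line (c : ℝ) {x : ℝ} (hx0 : x ≠ 0) :
    ContinuousWithinAt (fun y : ℝ => ((x : ℂ) + y * I) ^ (c : ℂ)) (Ici 0) 0 := by
  have hlin : Continuous fun y : ℝ => (x : ℂ) + y * I := by fun_prop
  rcases lt_or_gt_of_ne hx0 with hneg | hpos
  · have hc := continuousWithinAt_cpow_upper (e := c) (w₀ := (x : ℂ) + ((0 : ℝ) : ℂ) * I)
      (by simpa using hneg) (by simp)
    have h := hc.comp (f := fun y : ℝ => (x : ℂ) + y * I) hlin.continuousWithinAt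
      fun y hy => by
        show 0 ≤ ((x : ℂ) + y * I).im
        simpa using mem_Ici.mp hy
    exact h
  · have hs : (x : ℂ) + ((0 : ℝ) : ℂ) * I ∈ slitPlane := Or.inl (by simpa using hpos)
    have h := (continuousAt_cpow_const_of_mem hs (c : ℂ)).comp
      (f := fun y : ℝ => (x : ℂ) + y * I) hlin.continuousAt
    exact h.continuousWithinAt

/-- Continuity of `y ↦ (1-(x+iy))^c` at `y = 0`, `x < 1`. -/
theorem continuousAt_one_sub_cpow_line (c : ℝ) {x : ℝ} (hx : x < 1) :
    ContinuousAt (fun y : ℝ => (1 - ((x : ℂ) + y * I)) ^ (c : ℂ)) 0 := by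
  have hlin : Continuous fun y : ℝ => (x : ℂ) + y * I := by fun_prop
  have hs : 1 - ((x : ℂ) + ((0 : ℝ) : ℂ) * I) ∈ slitPlane := Or.inl (by simp; linarith)
  have h := (continuousAt_one_sub_cpow_const hs (c : ℂ)).comp
    (f := fun y : ℝ => (x : ℂ) + y * I) hlin.continuousAt
  exact h

/-- Continuity of `y ↦ g(x+iy)` from the closed upper half-plane at `y = 0`, for `x < ½`,
`x ≠ 0`. -/
theorem continuousWithinAt_gK (α β l m : ℝ) {x : ℝ} (hx : x < 1 / 2) (hx0 : x ≠ 0) :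
    ContinuousWithinAt (fun y : ℝ => gK α β l m (x + y * I)) (Ici 0) 0 := by
  have h1 : ContinuousWithinAt (fun y : ℝ => (l : ℂ) * ((x : ℂ) + y * I) ^ ((α + β : ℝ) : ℂ))
      (Ici 0) 0 := continuousWithinAt_const.mul (continuousWithinAt_cpow_line (α + β) hx0)
  have h2 : ContinuousWithinAt
      (fun y : ℝ => (m : ℂ) * (1 - ((x : ℂ) + y * I)) ^ ((α + β : ℝ) : ℂ)) (Ici 0) 0 :=
    continuousWithinAt_const.mul
      ((continuousAt_one_sub_cpow_line (α + β) (by linarith : x < 1)).continuousWithinAt)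
  exact ((continuousWithinAt_gTwo α β hx hx0).sub h1).sub h2

/-! ## Size and decay -/

/-- `|g(z)| ≤ |g_{αβ}(z)| + |λ| |z|^σ + |μ| |1-z|^σ`. -/
theorem norm_gK_le (α β l m : ℝ) (z : ℂ) :
    ‖gK α β l m z‖ ≤ ‖gTwo α β z‖ + |l| * ‖z‖ ^ (α + β) + |m| * ‖1 - z‖ ^ (α + β) := by
  rw [gK]
  refine (norm_sub_le _ _).trans (add_le_add ((norm_sub_le _ _).trans (add_le_add le_rfl ?_)) ?_)
  · rw [norm_mul, norm_real, Real.norm_eq_abs, norm_cpow_real]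
  · rw [norm_mul, norm_real, Real.norm_eq_abs, norm_cpow_real]

/-- `|g(x+iy)| ≤ (1 + |λ| + |μ|) y^σ` for `α, β ≤ 0`, `y > 0`. -/
theorem norm_gK_le_of_im {α β x y : ℝ} (l m : ℝ) (hα : α ≤ 0) (hβ : β ≤ 0) (hy : 0 < y) :
    ‖gK α β l m (x + y * I)‖ ≤ (1 + |l| + |m|) * y ^ (α + β) := by
  have hs : α + β ≤ 0 := by linarith
  have h1 : y ≤ ‖(x : ℂ) + y * I‖ := by
    have h := abs_im_le_norm ((x : ℂ) + y * I)
    rwa [show ((x : ℂ) + y * I).im = y by simp, abs_of_pos hy] at h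
  have h2 : y ≤ ‖1 - ((x : ℂ) + y * I)‖ := by
    have h := abs_im_le_norm (1 - ((x : ℂ) + y * I))
    rwa [show (1 - ((x : ℂ) + y * I)).im = -y by simp, abs_neg, abs_of_pos hy] at h
  have hA := norm_gTwo_le_of_im (x := x) hα hβ hy
  have hB : ‖(x : ℂ) + y * I‖ ^ (α + β) ≤ y ^ (α + β) := Real.rpow_le_rpow_of_nonpos hy h1 hs
  have hC : ‖1 - ((x : ℂ) + y * I)‖ ^ (α + β) ≤ y ^ (α + β) :=
    Real.rpow_le_rpow_of_nonpos hy h2 hs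
  calc ‖gK α β l m (x + y * I)‖ ≤ _ := norm_gK_le α β l m _
    _ ≤ y ^ (α + β) + |l| * y ^ (α + β) + |m| * y ^ (α + β) := by
        gcongr
    _ = (1 + |l| + |m|) * y ^ (α + β) := by ring

/-- `|g(x+iy)| ≤ (1 + |λ| + |μ|) (-x)^σ` for `α, β ≤ 0`, `x < 0`. -/
theorem norm_gK_le_of_re {α β x : ℝ} (l m : ℝ) (hα : α ≤ 0) (hβ : β ≤ 0) (hx : x < 0) (y : ℝ) :
    ‖gK α β l m (x + y * I)‖ ≤ (1 + |l| + |m|) * (-x) ^ (α + β) := by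
  have hs : α + β ≤ 0 := by linarith
  have hx' : 0 < -x := neg_pos.mpr hx
  have h1 : -x ≤ ‖(x : ℂ) + y * I‖ := by
    have h := abs_re_le_norm ((x : ℂ) + y * I)
    rwa [show ((x : ℂ) + y * I).re = x by simp, abs_of_neg hx] at h
  have h2 : -x ≤ ‖1 - ((x : ℂ) + y * I)‖ := by
    have h := abs_re_le_norm (1 - ((x : ℂ) + y * I))
    rw [show (1 - ((x : ℂ) + y * I)).re = 1 - x by simp, abs_of_pos (by linarith)] at h
    linarith
  have hA := norm_gTwo_le_of_re hα hβ hx y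
  have hB : ‖(x : ℂ) + y * I‖ ^ (α + β) ≤ (-x) ^ (α + β) := Real.rpow_le_rpow_of_nonpos hx' h1 hs
  have hC : ‖1 - ((x : ℂ) + y * I)‖ ^ (α + β) ≤ (-x) ^ (α + β) :=
    Real.rpow_le_rpow_of_nonpos hx' h2 hs
  calc ‖gK α β l m (x + y * I)‖ ≤ _ := norm_gK_le α β l m _
    _ ≤ (-x) ^ (α + β) + |l| * (-x) ^ (α + β) + |m| * (-x) ^ (α + β) := by
        gcongr
    _ = (1 + |l| + |m|) * (-x) ^ (α + β) := by ring

/-- `g(x+iy) → 0` as `y → +∞` (`α, β ≤ 0`, `α + β < 0`). -/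
theorem tendsto_gK_atTop {α β : ℝ} (l m : ℝ) (hα : α ≤ 0) (hβ : β ≤ 0) (hs : α + β < 0)
    (x : ℝ) : Tendsto (fun y : ℝ => gK α β l m (x + y * I)) atTop (𝓝 0) := by
  have hlim : Tendsto (fun y : ℝ => (1 + |l| + |m|) * y ^ (α + β)) atTop (𝓝 0) := by
    have h := (tendsto_rpow_neg_atTop (by linarith : 0 < -(α + β))).const_mul (1 + |l| + |m|)
    simpa using h
  refine squeeze_zero_norm' ?_ hlim
  filter_upwards [eventually_gt_atTop 0] with y hy
  exact norm_gK_le_of_im l m hα hβ hy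

/-- `g(x+iy) → 0` as `x → -∞` (`α, β ≤ 0`, `α + β < 0`). -/
theorem tendsto_gK_atBot {α β : ℝ} (l m : ℝ) (hα : α ≤ 0) (hβ : β ≤ 0) (hs : α + β < 0)
    (y : ℝ) : Tendsto (fun x : ℝ => gK α β l m (x + y * I)) atBot (𝓝 0) := by
  have hlim : Tendsto (fun x : ℝ => (1 + |l| + |m|) * (-x) ^ (α + β)) atBot (𝓝 0) := by
    have h := ((tendsto_rpow_neg_atTop (by linarith : 0 < -(α + β))).comp
      tendsto_neg_atBot_atTop).const_mul (1 + |l| + |m|)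
    simpa [Function.comp_def] using h
  refine squeeze_zero_norm' ?_ hlim
  filter_upwards [eventually_lt_atBot 0] with x hx
  exact norm_gK_le_of_re l m hα hβ hx y

end SoloBlind

end Summit.KontsevichZagierPeriods.KontsevichZagierPeriods.Theorems
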